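import Summits.Ventures.PercRepro.ProfilePointedLimit

/-!
# PercRepro — THE CAPTURED FIRST MOMENT IS «p PREFERS THE SPANNING SIDE»: (C1′) ⟺ (★)
(p10, gen 15; `proofs/P10-AVFULL.md` §23(c))

For a finite matroid `M` on `N = #E` elements and a point `p ∈ E`, let `DC` be the `p`-avoiding bi-independent sets
(all sizes; `avoidSets`), `𝒦 ⊆ DC` those capturing `p` (`capSets`), and the two CROSS-SPAN sums

  `S1 := Σ_{X ∈ DC} #(X ∩ cl(E ∖ X))`   (elements of `X` spanned by the other side, which contains `p`),
  `S2 := Σ_{X ∈ DC} #((E ∖ X) ∩ cl X)`  (elements of the `p`-side spanned by `X`).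

THE IDENTITY (kernel, in ProfilePointedSpanningIdentity): `Σ_{X ∈ 𝒦} (2 #X − N) = S1 − S2` (`sum_capSets_eq_cross`).  Proof: for every `e ≠ p` the move
`X ↦ X ∪ {e}` is a bijection `{X ∈ DC : e ∉ X, e ∉ cl X} → {X′ ∈ DC : e ∈ X′, e ∉ cl(E ∖ X′)}` (`card_avoid_move`), so
`#{X : e ∈ X} − #{X : e ∉ X} = #{X : e ∈ X ∩ cl(E∖X)} − #{X : e ∈ (E∖X) ∩ cl X}`; summing over `e ∈ E ∖ p` gives
`Σ_{DC} (2 #X − N + 1) = S1 − S2 + #𝒦` (`sum_avoid_signed`), while the complement `X ↦ (E ∖ p) ∖ X` is an involution of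
`DC ∖ 𝒦` reversing the sign of `2 #X − N + 1` (`sum_extSets_signed`).  Hence (C1′) `CapLimit` is equivalent to

  (★)  `S2 ≤ S1`   (`PointedSpanning`, NOT asserted; `capLimit_iff_pointedSpanning` in ProfilePointedSpanningIdentity):

over the `p`-avoiding bi-independent partitions, the side containing `p` spans at least as much of the other side as it
is spanned — equivalently, over the spanned triples `(A, B, x)` (`x ∈ B ∩ cl A`), the point `p` sits on the spanning side
at least as often as on the spanned side.  THIS FILE: the families, the move bijection (`card_avoid_move`), the per-element
count (`card_avoid_mem_sub`) and its four element-sums.  Nothing here asserts (★) or (C1′).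
-/

open scoped Matroid

namespace PercRepro.Cogirth

open Finset ThmH Skew

variable {α : Type} [DecidableEq α] {M : Matroid α} [M.Finite]

/-! ### Bi-independent sets of all sizes -/

/-- The bi-independent subsets of the ground set, all sizes. -/
noncomputable def biIndepAll (M : Matroid α) [M.Finite] : Finset (Finset α) :=
  (gr M).powerset.filter (fun X => rk M X = X.card ∧ rk M (gr M \ X) = (gr M \ X).card)

/-- Membership in `biIndepAll`. -/
theorem mem_biIndepAll {X : Finset α} :
    X ∈ biIndepAll M ↔ X ⊆ gr M ∧ rk M X = X.card ∧ rk M (gr M \ X) = (gr M \ X).card := by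
  unfold biIndepAll
  rw [mem_filter, mem_powerset]

/-- `biIndepAll` is the union of the levels: `X ∈ biIndepAll M ↔ X ∈ biIndepSets M #X`. -/
theorem mem_biIndepAll_iff {X : Finset α} : X ∈ biIndepAll M ↔ X ∈ biIndepSets M X.card := by
  rw [mem_biIndepAll, mem_biIndepSets]
  tauto

/-- The complement of a bi-independent set is bi-independent. -/
theorem sdiff_mem_biIndepAll {X : Finset α} (hX : X ∈ biIndepAll M) : gr M \ X ∈ biIndepAll M := by
  rw [mem_biIndepAll] at hX ⊢
  obtain ⟨hXg, hXr, hXc⟩ := hX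
  refine ⟨sdiff_subset, hXc, ?_⟩
  rw [Finset.sdiff_sdiff_eq_self hXg]
  exact hXr

/-- Adding a point `e ∉ X` keeps bi-independence iff `e ∉ cl X`. -/
theorem insert_mem_biIndepAll_iff {X : Finset α} (hX : X ∈ biIndepAll M) {e : α} (he : e ∈ gr M)
    (heX : e ∉ X) : insert e X ∈ biIndepAll M ↔ e ∉ clF M X := by
  rw [mem_biIndepAll_iff, card_insert_of_notMem heX]
  exact insert_mem_biIndepSets_iff (mem_biIndepAll_iff.1 hX) he heX

/-- Removing a point `e ∈ X` keeps bi-independence iff `e ∉ cl(E ∖ X)`. -/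
theorem erase_mem_biIndepAll_iff {X : Finset α} (hX : X ∈ biIndepAll M) {e : α} (heX : e ∈ X) :
    X.erase e ∈ biIndepAll M ↔ e ∉ clF M (gr M \ X) := by
  have hXg : X ⊆ gr M := (mem_biIndepAll.1 hX).1
  have heg : e ∈ gr M := hXg heX
  have hZ : gr M \ X ∈ biIndepAll M := sdiff_mem_biIndepAll hX
  have heZ : e ∉ gr M \ X := fun h => (mem_sdiff.1 h).2 heX
  have hcomp : gr M \ X.erase e = insert e (gr M \ X) := by
    ext x
    simp only [mem_sdiff, mem_erase, mem_insert, not_and]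
    constructor
    · rintro ⟨hxg, hx⟩
      by_cases hxe : x = e
      · exact Or.inl hxe
      · exact Or.inr ⟨hxg, hx hxe⟩
    · rintro (rfl | ⟨hxg, hx⟩)
      · exact ⟨heg, fun h => absurd rfl h⟩
      · exact ⟨hxg, fun _ => hx⟩
  rw [← insert_mem_biIndepAll_iff hZ heg heZ, ← hcomp]
  constructor
  · intro h
    exact sdiff_mem_biIndepAll h
  · intro h
    have h2 := sdiff_mem_biIndepAll h
    rwa [Finset.sdiff_sdiff_eq_self ((erase_subset e X).trans hXg)] at h2

/-! ### The `p`-avoiding family, the captured family, the two cross-span sums -/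

/-- `DC`: the `p`-avoiding bi-independent sets (all sizes). -/
noncomputable def avoidSets (M : Matroid α) [M.Finite] (p : α) : Finset (Finset α) :=
  (biIndepAll M).filter (fun X => p ∉ X)

/-- `𝒦`: the `p`-avoiding bi-independent sets capturing `p`. -/
noncomputable def capSets (M : Matroid α) [M.Finite] (p : α) : Finset (Finset α) :=
  (avoidSets M p).filter (fun X => p ∈ clF M X)

/-- `CC`: the `p`-avoiding bi-independent sets extending by `p`. -/
noncomputable def extSets (M : Matroid α) [M.Finite] (p : α) : Finset (Finset α) :=
  (avoidSets M p).filter (fun X => p ∉ clF M X)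

/-- `S1`: elements of `X` spanned by the `p`-side, summed over `DC`. -/
noncomputable def crossIn (M : Matroid α) [M.Finite] (p : α) : ℕ :=
  ∑ X ∈ avoidSets M p, (X ∩ clF M (gr M \ X)).card

/-- `S2`: elements of the `p`-side spanned by `X`, summed over `DC`. -/
noncomputable def crossOut (M : Matroid α) [M.Finite] (p : α) : ℕ :=
  ∑ X ∈ avoidSets M p, ((gr M \ X) ∩ clF M X).card

/-- **(★), «p PREFERS THE SPANNING SIDE» (NOT asserted)**: `S2 ≤ S1` for every finite matroid and every point. -/
def PointedSpanning (α : Type) [DecidableEq α] : Prop :=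
  ∀ (M : Matroid α) [M.Finite] (p : α), p ∈ gr M → crossOut M p ≤ crossIn M p

/-- Membership in `avoidSets`. -/
theorem mem_avoidSets {p : α} {X : Finset α} : X ∈ avoidSets M p ↔ X ∈ biIndepAll M ∧ p ∉ X := by
  unfold avoidSets
  rw [mem_filter]

/-- The level-`k` slice of `𝒦` is `κ_k`. -/
theorem card_capSets_filter (p : α) (k : ℕ) :
    ((capSets M p).filter (fun X => X.card = k)).card = capCount M k p := by
  unfold capCount capSets avoidSets
  apply congrArg Finset.card
  ext X
  simp only [mem_filter, mem_biIndepAll_iff]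
  constructor
  · rintro ⟨⟨⟨h1, h2⟩, h3⟩, h4⟩
    rw [h4] at h1
    exact ⟨h1, h2, h3⟩
  · rintro ⟨h1, h2, h3⟩
    have hk : X.card = k := (mem_biIndepSets.1 h1).2.1
    refine ⟨⟨⟨?_, h2⟩, h3⟩, hk⟩
    rw [hk]
    exact h1

/-! ### The move bijection and the per-element count -/

omit [DecidableEq α] in
/-- Double counting: `Σ_{e ∈ F} #{X ∈ A : P e X} = Σ_{X ∈ A} #{e ∈ F : P e X}`. -/
theorem sum_card_filter_comm (F : Finset α) (A : Finset (Finset α)) (P : α → Finset α → Prop)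
    [∀ e X, Decidable (P e X)] :
    ∑ e ∈ F, (A.filter (fun X => P e X)).card = ∑ X ∈ A, (F.filter (fun e => P e X)).card := by
  simp_rw [card_filter]
  exact sum_comm

/-- **THE MOVE `X ↦ X ∪ {e}`** is a bijection from the `p`-avoiding sets with `e ∉ X`, `e ∉ cl X` onto those with
`e ∈ X′`, `e ∉ cl(E ∖ X′)`. -/
theorem card_avoid_move {p e : α} (he : e ∈ gr M) (hep : e ≠ p) :
    ((avoidSets M p).filter (fun X => e ∉ X ∧ e ∉ clF M X)).card =
      ((avoidSets M p).filter (fun X => e ∈ X ∧ e ∉ clF M (gr M \ X))).card := by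
  apply card_bij (fun X _ => insert e X)
  · intro X hX
    rw [mem_filter, mem_avoidSets] at hX
    obtain ⟨⟨hXb, hpX⟩, heX, hcl⟩ := hX
    have hins : insert e X ∈ biIndepAll M := (insert_mem_biIndepAll_iff hXb he heX).2 hcl
    rw [mem_filter, mem_avoidSets]
    refine ⟨⟨hins, ?_⟩, mem_insert_self e X, ?_⟩
    · rw [mem_insert, not_or]
      exact ⟨fun h => hep h.symm, hpX⟩
    · have h2 := (erase_mem_biIndepAll_iff hins (mem_insert_self e X)).1
      rw [erase_insert heX] at h2
      exact h2 hXb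
  · intro X₁ hX₁ X₂ hX₂ h
    have h1 : e ∉ X₁ := ((mem_filter.1 hX₁).2).1
    have h2 : e ∉ X₂ := ((mem_filter.1 hX₂).2).1
    rw [← erase_insert h1, ← erase_insert h2, h]
  · intro X' hX'
    rw [mem_filter, mem_avoidSets] at hX'
    obtain ⟨⟨hXb, hpX⟩, heX, hcl⟩ := hX'
    have hXe : X'.erase e ∈ biIndepAll M := (erase_mem_biIndepAll_iff hXb heX).2 hcl
    refine ⟨X'.erase e, ?_, insert_erase heX⟩
    rw [mem_filter, mem_avoidSets]
    refine ⟨⟨hXe, fun h => hpX (mem_of_mem_erase h)⟩, notMem_erase e X', ?_⟩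
    have h3 := (insert_mem_biIndepAll_iff hXe he (notMem_erase e X')).1
    rw [insert_erase heX] at h3
    exact h3 hXb

/-- The per-element count (in `ℤ`): `#{X : e ∈ X} − #{X : e ∉ X} = #{X : e ∈ X ∩ cl(E∖X)} − #{X : e ∈ (E∖X) ∩ cl X}`. -/
theorem card_avoid_mem_sub {p e : α} (he : e ∈ gr M) (hep : e ≠ p) :
    (((avoidSets M p).filter (fun X => e ∈ X)).card : ℤ) -
        ((avoidSets M p).filter (fun X => e ∉ X)).card =
      (((avoidSets M p).filter (fun X => e ∈ X ∧ e ∈ clF M (gr M \ X))).card : ℤ) -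
        ((avoidSets M p).filter (fun X => e ∉ X ∧ e ∈ clF M X)).card := by
  have hmove := card_avoid_move (M := M) he hep
  have h1 := card_filter_add_card_filter_not (s := (avoidSets M p).filter (fun X => e ∈ X))
    (fun X => e ∈ clF M (gr M \ X))
  have h2 := card_filter_add_card_filter_not (s := (avoidSets M p).filter (fun X => e ∉ X))
    (fun X => e ∈ clF M X)
  rw [filter_filter, filter_filter] at h1 h2
  have h1' : ((avoidSets M p).filter (fun X => e ∈ X)).card =
      ((avoidSets M p).filter (fun X => e ∈ X ∧ e ∈ clF M (gr M \ X))).card +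
        ((avoidSets M p).filter (fun X => e ∈ X ∧ e ∉ clF M (gr M \ X))).card := h1.symm
  have h2' : ((avoidSets M p).filter (fun X => e ∉ X)).card =
      ((avoidSets M p).filter (fun X => e ∉ X ∧ e ∈ clF M X)).card +
        ((avoidSets M p).filter (fun X => e ∉ X ∧ e ∉ clF M X)).card := h2.symm
  rw [h1', h2', hmove]
  push_cast
  ring

/-! ### Summing over the elements: the two identities -/

/-- A `p`-avoiding set lies in `E ∖ p`. -/
theorem subset_erase_of_mem_avoidSets {p : α} {X : Finset α} (hX : X ∈ avoidSets M p) :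
    X ⊆ (gr M).erase p := by
  rw [mem_avoidSets] at hX
  intro x hx
  rw [mem_erase]
  exact ⟨fun h => hX.2 (h ▸ hx), (mem_biIndepAll.1 hX.1).1 hx⟩

/-- `Σ_{e ∈ E∖p} #{X ∈ DC : e ∈ X} = Σ_{X ∈ DC} #X`. -/
theorem sum_card_avoid_mem (p : α) :
    ∑ e ∈ (gr M).erase p, ((avoidSets M p).filter (fun X => e ∈ X)).card =
      ∑ X ∈ avoidSets M p, X.card := by
  rw [sum_card_filter_comm]
  apply sum_congr rfl
  intro X hX
  rw [filter_mem_eq_inter, inter_eq_right.2 (subset_erase_of_mem_avoidSets hX)]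

/-- `Σ_{e ∈ E∖p} #{X ∈ DC : e ∉ X} = Σ_{X ∈ DC} (N − 1 − #X)`. -/
theorem sum_card_avoid_notMem {p : α} (hp : p ∈ gr M) :
    ∑ e ∈ (gr M).erase p, ((avoidSets M p).filter (fun X => e ∉ X)).card =
      ∑ X ∈ avoidSets M p, ((gr M).card - 1 - X.card) := by
  rw [sum_card_filter_comm]
  apply sum_congr rfl
  intro X hX
  have h1 : ((gr M).erase p).filter (fun e => e ∉ X) = (gr M).erase p \ X := by
    ext e
    simp only [mem_filter, mem_sdiff]
  rw [h1, card_sdiff_of_subset (subset_erase_of_mem_avoidSets hX), card_erase_of_mem hp]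

/-- `Σ_{e ∈ E∖p} #{X ∈ DC : e ∈ X ∩ cl(E∖X)} = S1`. -/
theorem sum_card_avoid_crossIn (p : α) :
    ∑ e ∈ (gr M).erase p, ((avoidSets M p).filter (fun X => e ∈ X ∧ e ∈ clF M (gr M \ X))).card =
      crossIn M p := by
  unfold crossIn
  rw [sum_card_filter_comm]
  apply sum_congr rfl
  intro X hX
  have h1 : ((gr M).erase p).filter (fun e => e ∈ X ∧ e ∈ clF M (gr M \ X)) = X ∩ clF M (gr M \ X) := by
    ext e
    simp only [mem_filter, mem_inter]
    constructor
    · rintro ⟨_, h⟩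
      exact h
    · rintro ⟨h1, h2⟩
      exact ⟨subset_erase_of_mem_avoidSets hX h1, h1, h2⟩
  rw [h1]

/-- `Σ_{e ∈ E∖p} #{X ∈ DC : e ∈ (E∖X) ∩ cl X} + #𝒦 = S2` (the term `e = p` of `S2` counts exactly `𝒦`). -/
theorem sum_card_avoid_crossOut {p : α} (hp : p ∈ gr M) :
    ∑ e ∈ (gr M).erase p, ((avoidSets M p).filter (fun X => e ∉ X ∧ e ∈ clF M X)).card +
      (capSets M p).card = crossOut M p := by
  unfold crossOut capSets
  rw [sum_card_filter_comm, card_filter, ← sum_add_distrib]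
  apply sum_congr rfl
  intro X hX
  have hpX : p ∉ X := (mem_avoidSets.1 hX).2
  have h1 : ((gr M).erase p).filter (fun e => e ∉ X ∧ e ∈ clF M X) = ((gr M \ X) ∩ clF M X).erase p := by
    ext e
    simp only [mem_filter, mem_erase, mem_inter, mem_sdiff]
    tauto
  rw [h1]
  by_cases hcl : p ∈ clF M X
  · have hmem : p ∈ (gr M \ X) ∩ clF M X := mem_inter.2 ⟨mem_sdiff.2 ⟨hp, hpX⟩, hcl⟩
    rw [card_erase_of_mem hmem, if_pos hcl]
    have := card_pos.2 ⟨p, hmem⟩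
    omega
  · have hmem : p ∉ (gr M \ X) ∩ clF M X := fun h => hcl (mem_inter.1 h).2
    rw [erase_eq_of_notMem hmem, if_neg hcl, add_zero]

end PercRepro.Cogirth
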